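import Summits.HodgeConjecture.HodgeConjecture.Theorems.SixfoldTableXCensusIsogeny
import Summits.HodgeConjecture.HodgeConjecture.Theorems.SixfoldTableXClasses
import Literature.AlgebraicGeometry.VanGeemen1994.HodgeGroupLeSUWeilType
import Literature.AlgebraicGeometry.HodgeTheory.WeilClassesRationalPlane
import HarnessLib

/-!
# TABLE X (dimension 6) — row 9 `g6.Weil.k.(3,3).general`, the GENERAL member of a Weil-type component (`Hg = SU_H`):
# the census nodes X2 / X1 DISCHARGED IN THE KERNEL, with domain membership, unconditionally; and the Hodge conjecture
# for these sixfolds from the NAMED residues {Markman₆, R-W6} ALONE — the two census nodes drop out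
# (cell `pub-hodgeav-hg6`, req-37 (A) Q2b; eng-4 g4, L12; lead g2 2026-08-28T21:17:41Z)

HONEST FRAMING. HC, `HC_AV` (stmt-1333), `HC_CM` (stmt-3052) and the rung H2 are NOT proved and do not occur here. The
census nodes X2 / X1 (`TableX.SixfoldCodimTwoCensus` / `TableX.SixfoldCodimThreeCensus` of `SixfoldTableXCover`) are OURS
(`@[conjecture]`), never asserted; the residue R-W6 (`WeilTypeLadder.NonsplitSixfolds`) and Markman's hyperbolic-sixfold
theorem (`Markman2025_weilClasses_algebraic_hyperbolicSixfold`, preprint, UNREFEREED) appear ONLY as displayed hypotheses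
of §3. KERNEL ONLY: theorems over existing declarations; no definition, no `sorry`, no named fact used as an axiom; the
algebraicity of Weil classes is NOT touched; typed ≠ proved.

WHY THIS MODULE (census-node self-audit, axis A7 «a row VERIFIED in the kernel, not by dossier», continued; A7 inventory
`HOME/jobs/A7-inventory-eng4g4/INVENTORY.md` row 9). The census node X1 was DESIGNED with a last summand «rational
`(3,3)` Weil classes of sixfolds `(B′, ψ)`, pushed along `g : A.X ⟶ B′.X`», so that on a sixfold whose Hodge ring is
generated by divisor classes and its own Weil plane the node holds BY DESIGN. For the GENERAL member of a Weil-type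
component — `Hg(A) = SU_H` in van Geemen's sense, the tree's `VanGeemen1994.HasHodgeGroupSU A φ 3 d h_K` with
`h_K = d·e^*a + φ^*e^*a` — that Hodge ring IS a tree theorem: van Geemen 1994 Thm. 6.12 (corrected), PROVED in
`VanGeemen1994/WeilTypeHodgeRingOfSU` (`VanGeemen1994_thm612_corrected_holds`) and freed of its Weil-type hypothesis in
`VanGeemen1994/HodgeGroupLeSUWeilType` (`divisorWeilGenerated_of_hasHodgeGroupSU'`: `Bᵖ = Dᵖ ⊗ ℂ` for `p ≠ 3` and
`B³ ⊆ D³ ⊗ ℂ ⊔ W_K ⊗ ℂ`), together with `weilClassesOf_eq_span_isRationalClass` (van Geemen 4.9: `W_K ⊗ ℂ` is spanned by its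
RATIONAL members) and `isOfHodgeType_of_mem_weilClassesOf_of_hasHodgeGroupSU` (each is of type `(3,3)`). L7
(`SixfoldTableXClasses` §3) already placed exactly these members in the nodes' domain (`mem_offResidueSix_of_hasHodgeGroupSU`)
and then took `hX2 hX1` as HYPOTHESES at them (`hodgeConjectureFor_generalWeilSixfold_of_tableX_residues`). This file
discharges them:
* §1 `WeilRows.weilClassesOf_le_weilSummand` — `W_K(A) ⊗ ℂ ≤` X1's sixfold-Weil summand at `A` (`B′ = A`, `g = 𝟙`, `ψ = φ`).
* §2 **`WeilRows.census_row9_generalWeil`** — for `A` with `dim A = 6`, `φ ≫ φ = −d` (`d > 0`), a projective embedding `e`,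
  a rational class `a ≠ 0` on the ambient projective space and `HasHodgeGroupSU A φ 3 d h_K`: `(dim A = 6 ∧ ¬ 𝒞 A)` ∧ X2-at-`A` ∧
  X1-at-`A`, UNCONDITIONAL; `WeilRows.census_row9_generalWeil_of_isIsogenous` — the same at every `A′ ∼ A` (L7 / L7b transport).
* §3 **`WeilRows.hodgeConjectureFor_generalWeilSixfold_of_markman₆_nonsplit`** — THE POINT: L7's
  `hodgeConjectureFor_generalWeilSixfold_of_tableX_residues` had binders {Markman₄, Markman₆, R-W6, X2, X1}; for the general
  Weil sixfold HC(A) follows from {Markman₆, R-W6} ALONE: `Hg = SU_H` makes HC(A) EQUIVALENT to the algebraicity of `A`'s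
  own rational `(3,3)` Weil classes (`hodgeConjectureFor_iff_weilClasses_of_hasHodgeGroupSU'`), and those are algebraic on
  EVERY sixfold by `WeilSixfolds` = Markman₆ (hyperbolic = split case) + `NonsplitSixfolds` (the rest)
  (`WeilTypeLadder.weilSixfolds_of_nonsplitSixfolds_of_floor`). Markman₄ is NOT needed (no fourfold occurs), and the two
  `@[conjecture]` census nodes DROP OUT of the general-Weil row entirely. Also the R-W6-free reading for completeness:
  `…_of_weilSixfolds` (binder = the ladder item `SevenfoldWeilCensus.WeilSixfolds` alone).
WHAT IS NOT COVERED (honest scope): the SPECIAL members of row 9 (`Hg ⊊ SU_H`), rows 11 / 13 (`End⁰ ⊋ k`: `HasHodgeGroupSU`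
forces `End⁰(A) = k`, `finrank_endAlgebra_eq_two_of_hasHodgeGroupSU`), row 7 (type III(1)) and the product Weil rows
17 / 19 / 20 / 21 / 22 / 27 — no tree Hodge-ring theorem there. No inhabitant is exhibited here (the tree's portrait file
`VanGeemen1994/WeilTypeGeneralMemberPortrait` is about members GIVEN `HasHodgeGroupSU`; existence of such sixfolds is van
Geemen 6.11, not restated).

All declarations in the sub-namespace `TableX.WeilRows`. Nothing here is a corollary of `HC_CM`; no hypothesis of the cover
is discharged GLOBALLY (X2 / X1 quantify over ALL off-residue sixfolds and stay `@[conjecture]`); the algebraicity of Weil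
classes (rung H2 / R-W6 / Markman₆) is untouched; typed ≠ proved.
-/

set_option linter.dupNamespace false

noncomputable section

open CategoryTheory
open Literature.AlgebraicGeometry Literature.AlgebraicGeometry.Motives
open Literature.AlgebraicGeometry.Motives.AbelianVariety (IsIsogenous IsSimple)
open Literature.AlgebraicGeometry.HodgeTheory
open Literature.AlgebraicGeometry.Milne1999
open Literature.AlgebraicGeometry.VanGeemen1994 (HasHodgeGroupSU hK divisorWeilGenerated_of_hasHodgeGroupSU'
  isOfHodgeType_of_mem_weilClassesOf_of_hasHodgeGroupSU hodgeConjectureFor_iff_weilClasses_of_hasHodgeGroupSU')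
open Literature.AlgebraicTopology.SingularHomology
open Literature.Barriers.HodgeConjecture
open Summit.HodgeConjecture.HodgeConjecture.Ring2.ClassTargets
open Summit.HodgeConjecture.HodgeConjecture.Ring2.Motiv (ProdCMCell)
open Summit.HodgeConjecture.HodgeConjecture.Ring2.Atlas (IsQuarticFieldTypeIVFourfold)

namespace Summit.HodgeConjecture.HodgeConjecture.TableX.WeilRows

variable (A : AbelianVariety ℂ) (φ : A ⟶ A) (d : ℕ) (e : ProjectiveEmbedding A.X)
  (a : complexBetti (projectiveSpace e.n ℂ) 2)

/-! ## §1 The Weil plane of the general member sits inside X1's sixfold-Weil summand -/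

/-- **`W_K(A) ⊗ ℂ ≤` the sixfold-Weil summand of X1 at `A`** for the general member (`Hg = SU_H`): `W_K ⊗ ℂ` is the
complex span of its RATIONAL members (van Geemen 4.9, `weilClassesOf_eq_span_isRationalClass`), each of which is of Hodge
type `(3,3)` under `Hg = SU_H` (`isOfHodgeType_of_mem_weilClassesOf_of_hasHodgeGroupSU`) and is its own push-forward along
`g = 𝟙 A.X` from `B′ = A`, `ψ = φ`. [cite: vanGeemen1994HodgeAV, 4.9–4.10 and Thm. 6.11]
[cite: MoonenZarhin1998WeilClasses, §1 Remark (p. 1)] -/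
theorem weilClassesOf_le_weilSummand (hd : 0 < d) (hA : A.dim = 2 * 3) (hφ : φ ≫ φ = -(d • 𝟙 A))
    (hSU : HasHodgeGroupSU A φ 3 d (hK d φ e a)) :
    weilClassesOf A φ 3 d ≤ Submodule.span ℂ {w' : complexBetti A.X (2 * 3) |
      ∃ (B' : AbelianVariety ℂ) (g : A.X ⟶ B'.X) (d : ℕ) (ψ : B' ⟶ B') (w : complexBetti B'.X (2 * 3)),
        B'.dim = 6 ∧ 0 < d ∧ ψ ≫ ψ = -(d • 𝟙 B') ∧ IsRationalClass w ∧
        IsOfHodgeType B'.dim B'.X (2 * 3) 3 3 w ∧ w ∈ weilClassesOf B' ψ 3 d ∧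
        w' = complexBetti.map g (2 * 3) w} := by
  rw [weilClassesOf_eq_span_isRationalClass (by norm_num) hA hd hφ]
  refine Submodule.span_mono ?_
  rintro c ⟨hcQ, hcW⟩
  refine ⟨A, 𝟙 A.X, d, φ, c, by omega, hd, hφ, hcQ, ?_, hcW, ?_⟩
  · rw [hA]; exact isOfHodgeType_of_mem_weilClassesOf_of_hasHodgeGroupSU hd hA hφ hSU hcW
  · rw [complexBetti.map_id]; rfl

/-! ## §2 Row 9, general member: domain membership and both census conclusions, in the kernel -/

/-- **TABLE X ROW 9 `g6.Weil.k.(3,3)`, GENERAL MEMBER (`Hg = SU_H`), KERNEL VERDICT WITH DOMAIN MEMBERSHIP.** For a complex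
abelian sixfold `A` with `φ ≫ φ = −d` (`d > 0`), a projective embedding `e`, a rational class `a ≠ 0` on the ambient
projective space and `Hg(A) = SU_H` for `h_K = d·e^*a + φ^*e^*a` (`HasHodgeGroupSU A φ 3 d h_K` — van Geemen's general
member of the Weil-type component): `dim A = 6 ∧ ¬ 𝒞 A` (L7 `mem_offResidueSix_of_hasHodgeGroupSU`: simple, not CM), AND
X2-at-`A` (`B² = D² ⊗ ℂ`, van Geemen 6.12 (iii) at `p = 2 ≠ 3`: the divisor summand alone) AND X1-at-`A` (`B³ ⊆ D³ ⊗ ℂ ⊔ W_K ⊗ ℂ`,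
6.12 (iv), and §1: the divisor summand and the sixfold-Weil summand). UNCONDITIONAL (vG94 Thm. 6.12 is the tree theorem
`VanGeemen1994_thm612_corrected_holds`). [cite: vanGeemen1994HodgeAV, Thm. 6.12, Thm. 4.11 and 4.9]
[cite: MoonenZarhin1999LowDim, Thm. 0.2 and §5 (5.1)] [cite: MoonenZarhin1998WeilClasses, §1] -/
theorem census_row9_generalWeil (hd : 0 < d) (hA : A.dim = 2 * 3) (hφ : φ ≫ φ = -(d • 𝟙 A))
    (ha : IsRationalClass a) (ha0 : a ≠ 0) (hSU : HasHodgeGroupSU A φ 3 d (hK d φ e a)) :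
    (A.dim = 6 ∧ ¬ (IsOfCMType A ∨ ProdCMCell IsQuarticFieldTypeIVFourfold (fun Z ↦ Z.dim = 2) A)) ∧
    (∀ c : complexBetti A.X (2 * 2), IsRationalClass c → IsOfHodgeType A.dim A.X (2 * 2) 2 2 c →
      c ∈ divisorClassesSpan A.X A.dim 2 ⊔ Submodule.span ℂ {w' : complexBetti A.X (2 * 2) |
        ∃ (C : AbelianVariety ℂ) (g : A.X ⟶ C.X) (w : complexBetti C.X (2 * 2)), C.dim < A.dim ∧
          IsRationalClass w ∧ IsOfHodgeType C.dim C.X (2 * 2) 2 2 w ∧ w' = complexBetti.map g (2 * 2) w}) ∧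
    (∀ c : complexBetti A.X (2 * 3), IsRationalClass c → IsOfHodgeType A.dim A.X (2 * 3) 3 3 c →
      c ∈ divisorClassesSpan A.X A.dim 3 ⊔ Submodule.span ℂ {w' : complexBetti A.X (2 * 3) |
          ∃ (a : complexBetti A.X (2 * 2)) (b : complexBetti A.X (2 * 1)),
            IsRationalClass a ∧ IsOfHodgeType A.dim A.X (2 * 2) 2 2 a ∧ IsRationalClass b ∧
            IsOfHodgeType A.dim A.X (2 * 1) 1 1 b ∧ w' = cupProduct (two_mul_add_two_mul 2 1) a b} ⊔
        Submodule.span ℂ {w' : complexBetti A.X (2 * 3) |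
          ∃ (C : AbelianVariety ℂ) (g : A.X ⟶ C.X) (w : complexBetti C.X (2 * 3)), C.dim < A.dim ∧
            IsRationalClass w ∧ IsOfHodgeType C.dim C.X (2 * 3) 3 3 w ∧ w' = complexBetti.map g (2 * 3) w} ⊔
        Submodule.span ℂ {w' : complexBetti A.X (2 * 3) |
          ∃ (B' : AbelianVariety ℂ) (g : A.X ⟶ B'.X) (d : ℕ) (ψ : B' ⟶ B') (w : complexBetti B'.X (2 * 3)),
            B'.dim = 6 ∧ 0 < d ∧ ψ ≫ ψ = -(d • 𝟙 B') ∧ IsRationalClass w ∧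
            IsOfHodgeType B'.dim B'.X (2 * 3) 3 3 w ∧ w ∈ weilClassesOf B' ψ 3 d ∧
            w' = complexBetti.map g (2 * 3) w}) := by
  obtain ⟨hBD, hB3⟩ := divisorWeilGenerated_of_hasHodgeGroupSU' A φ 3 d e a (by norm_num) hd hA hφ ha ha0 hSU
  refine ⟨mem_offResidueSix_of_hasHodgeGroupSU A φ d e a hd hA hφ ha ha0 hSU, fun c hcQ hcH ↦ ?_,
    fun c hcQ hcH ↦ ?_⟩
  · exact Submodule.mem_sup_left (hBD 2 c (by norm_num) hcQ hcH)
  · obtain ⟨x, hx, y, hy, rfl⟩ := Submodule.mem_sup.1 (hB3 c hcQ hcH)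
    exact Submodule.add_mem _ (Submodule.mem_sup_left (Submodule.mem_sup_left (Submodule.mem_sup_left hx)))
      (Submodule.mem_sup_right (weilClassesOf_le_weilSummand A φ d e a hd hA hφ hSU hy))

/-- **Row 9, general member, on the whole ISOGENY CLASS**: everything isogenous to a general Weil-type sixfold is in the
nodes' domain and satisfies both census conclusions (L7 `offResidueSix_iff_of_isIsogenous`, L7b
`codimTwo/ThreeCensusAt_iff_of_isIsogenous`). UNCONDITIONAL. [cite: vanGeemen1994HodgeAV, Thm. 6.12 and Lemma 3.7]
[cite: MoonenZarhin1999LowDim, §5 (5.1)] -/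
theorem census_row9_generalWeil_of_isIsogenous {A' : AbelianVariety ℂ} (hd : 0 < d) (hA : A.dim = 2 * 3)
    (hφ : φ ≫ φ = -(d • 𝟙 A)) (ha : IsRationalClass a) (ha0 : a ≠ 0) (hSU : HasHodgeGroupSU A φ 3 d (hK d φ e a))
    (hA'A : IsIsogenous A' A) :
    (A'.dim = 6 ∧ ¬ (IsOfCMType A' ∨ ProdCMCell IsQuarticFieldTypeIVFourfold (fun Z ↦ Z.dim = 2) A')) ∧
    (∀ c : complexBetti A'.X (2 * 2), IsRationalClass c → IsOfHodgeType A'.dim A'.X (2 * 2) 2 2 c →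
      c ∈ divisorClassesSpan A'.X A'.dim 2 ⊔ Submodule.span ℂ {w' : complexBetti A'.X (2 * 2) |
        ∃ (C : AbelianVariety ℂ) (g : A'.X ⟶ C.X) (w : complexBetti C.X (2 * 2)), C.dim < A'.dim ∧
          IsRationalClass w ∧ IsOfHodgeType C.dim C.X (2 * 2) 2 2 w ∧ w' = complexBetti.map g (2 * 2) w}) ∧
    (∀ c : complexBetti A'.X (2 * 3), IsRationalClass c → IsOfHodgeType A'.dim A'.X (2 * 3) 3 3 c →
      c ∈ divisorClassesSpan A'.X A'.dim 3 ⊔ Submodule.span ℂ {w' : complexBetti A'.X (2 * 3) |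
          ∃ (a : complexBetti A'.X (2 * 2)) (b : complexBetti A'.X (2 * 1)),
            IsRationalClass a ∧ IsOfHodgeType A'.dim A'.X (2 * 2) 2 2 a ∧ IsRationalClass b ∧
            IsOfHodgeType A'.dim A'.X (2 * 1) 1 1 b ∧ w' = cupProduct (two_mul_add_two_mul 2 1) a b} ⊔
        Submodule.span ℂ {w' : complexBetti A'.X (2 * 3) |
          ∃ (C : AbelianVariety ℂ) (g : A'.X ⟶ C.X) (w : complexBetti C.X (2 * 3)), C.dim < A'.dim ∧
            IsRationalClass w ∧ IsOfHodgeType C.dim C.X (2 * 3) 3 3 w ∧ w' = complexBetti.map g (2 * 3) w} ⊔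
        Submodule.span ℂ {w' : complexBetti A'.X (2 * 3) |
          ∃ (B' : AbelianVariety ℂ) (g : A'.X ⟶ B'.X) (d : ℕ) (ψ : B' ⟶ B') (w : complexBetti B'.X (2 * 3)),
            B'.dim = 6 ∧ 0 < d ∧ ψ ≫ ψ = -(d • 𝟙 B') ∧ IsRationalClass w ∧
            IsOfHodgeType B'.dim B'.X (2 * 3) 3 3 w ∧ w ∈ weilClassesOf B' ψ 3 d ∧
            w' = complexBetti.map g (2 * 3) w}) := by
  obtain ⟨hdom, h2, h3⟩ := census_row9_generalWeil A φ d e a hd hA hφ ha ha0 hSU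
  exact ⟨(offResidueSix_iff_of_isIsogenous hA'A).mpr hdom, (codimTwoCensusAt_iff_of_isIsogenous hA'A).mpr h2,
    (codimThreeCensusAt_iff_of_isIsogenous hA'A).mpr h3⟩

/-! ## §3 HC for the general Weil sixfold from the named residues alone: the census nodes drop out -/

/-- **HC for the general Weil-type sixfold from the ladder item `WeilSixfolds` ALONE** (no census node, no Markman₄, no
`HC_CM`): under `Hg = SU_H`, HC(A) ⟺ the rational `(3,3)` Weil classes of `A` are algebraic
(`hodgeConjectureFor_iff_weilClasses_of_hasHodgeGroupSU'`, van Geemen 6.12 + Lefschetz (1,1)), and `WeilSixfolds`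
(`SevenfoldWeilCensus.WeilSixfolds`, stmt-HodgeConjecture-2524, in its `weilClassesOf` reading
`WeilTypeLadder.weilSixfolds_iff_weilClassesOf`) is exactly that algebraicity on every sixfold. The binder is displayed,
not asserted. [cite: vanGeemen1994HodgeAV, 2.4, Thm. 4.11 and Thm. 6.12] [cite: MoonenZarhin1999LowDim, Thm. 0.2] -/
theorem hodgeConjectureFor_generalWeilSixfold_of_weilSixfolds (hW₆ : Theses.SevenfoldWeilCensus.WeilSixfolds)
    (hd : 0 < d) (hA : A.dim = 2 * 3) (hφ : φ ≫ φ = -(d • 𝟙 A)) (ha : IsRationalClass a) (ha0 : a ≠ 0)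
    (hSU : HasHodgeGroupSU A φ 3 d (hK d φ e a)) : HodgeConjectureFor A.dim A.X :=
  (hodgeConjectureFor_iff_weilClasses_of_hasHodgeGroupSU' A φ 3 d e a (by norm_num) hd hA hφ ha ha0 hSU).mpr
    (WeilTypeLadder.weilSixfolds_iff_weilClassesOf.mp hW₆ d hd A φ hA
      (hA ▸ AbelianVariety.isSmoothProjective_holds (A := A)) hφ)

/-- **HC for the general Weil-type sixfold from the NAMED RESIDUES {Markman₆, R-W6} ALONE — L7's
`hodgeConjectureFor_generalWeilSixfold_of_tableX_residues` WITHOUT its binders Markman₄, X2, X1.** GRANTED Markman's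
hyperbolic-sixfold theorem (`Markman2025_weilClasses_algebraic_hyperbolicSixfold`, arXiv:2502.03415 Thm. 1.5.1, preprint,
UNREFEREED; the split / discriminant-`−1` range) and the residue R-W6 = `WeilTypeLadder.NonsplitSixfolds` (Weil classes on
the sixfolds with NO hyperbolic `K`-symmetrised hyperplane class; OPEN), every sixfold's rational `(3,3)` Weil classes are
algebraic (`WeilTypeLadder.weilSixfolds_of_nonsplitSixfolds_of_floor`), hence HC holds at every general Weil-type sixfold
(previous theorem). The two `@[conjecture]` census nodes and Markman₄ do not occur: for THIS row they were never needed.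
None of the two displayed hypotheses is asserted; the algebraicity of Weil classes is not touched.
[cite: Markman2025SecantWeil, Thm. 1.5.1 (preprint, unrefereed)] [claim: Markman2025SurveySecant, status: under-review]
[cite: vanGeemen1994HodgeAV, Thm. 6.12] [cite: MoonenZarhin1999LowDim, Thm. 0.2] -/
theorem hodgeConjectureFor_generalWeilSixfold_of_markman₆_nonsplit
    (hMark₆ : Markman2025_weilClasses_algebraic_hyperbolicSixfold) (hRW6 : WeilTypeLadder.NonsplitSixfolds)
    (hd : 0 < d) (hA : A.dim = 2 * 3) (hφ : φ ≫ φ = -(d • 𝟙 A)) (ha : IsRationalClass a) (ha0 : a ≠ 0)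
    (hSU : HasHodgeGroupSU A φ 3 d (hK d φ e a)) : HodgeConjectureFor A.dim A.X :=
  hodgeConjectureFor_generalWeilSixfold_of_weilSixfolds A φ d e a
    (WeilTypeLadder.weilSixfolds_of_nonsplitSixfolds_of_floor hMark₆ hRW6) hd hA hφ ha ha0 hSU

/-- **… and on the whole isogeny class** (van Geemen Lemma 3.7 = `HodgeConjectureFor.of_isIsogenous`).
[cite: vanGeemen1994HodgeAV, Lemma 3.7 and Thm. 6.12] [cite: Markman2025SecantWeil, Thm. 1.5.1 (preprint, unrefereed)] -/
theorem hodgeConjectureFor_of_isIsogenous_generalWeilSixfold_of_markman₆_nonsplit {A' : AbelianVariety ℂ}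
    (hMark₆ : Markman2025_weilClasses_algebraic_hyperbolicSixfold) (hRW6 : WeilTypeLadder.NonsplitSixfolds)
    (hd : 0 < d) (hA : A.dim = 2 * 3) (hφ : φ ≫ φ = -(d • 𝟙 A)) (ha : IsRationalClass a) (ha0 : a ≠ 0)
    (hSU : HasHodgeGroupSU A φ 3 d (hK d φ e a)) (hA'A : IsIsogenous A' A) : HodgeConjectureFor A'.dim A'.X :=
  HodgeConjectureFor.of_isIsogenous hA'A
    (hodgeConjectureFor_generalWeilSixfold_of_markman₆_nonsplit A φ d e a hMark₆ hRW6 hd hA hφ ha ha0 hSU)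

end Summit.HodgeConjecture.HodgeConjecture.TableX.WeilRows
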